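import Summits.CriticalPhenomena.PercolationContinuityZ3.Theorems.Transplant.SkelPhiNegReachReadB
import Summits.CriticalPhenomena.PercolationContinuityZ3.Theorems.Transplant.SkelPhiNegReachRecs
import HarnessLib

/-!
# N1 (the `{±1}` node), (C) column file (C-S9b): THE ROOMS OF THE LOCALISATION ROUNDS at the record values of RULING B.15 (S1) — the
# hypotheses `hrdA / hrdA'` (signed v-rounds `vLocPrmD n ℓ h v T W_A L0_A N_A`, axis `1`) and `hrd₂ / hrd₂'` (u-rounds `xLocPrm n ℓ h T W_B L0_B N_B`,
# axis `0`) of `reachOblRHN_negSG₂b(_of_inputs)`: every region of either segment reads, in the cell map, inside `±(2r_i − 1)` on both axes (so inside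
# every room, either corridor sign, with one unit of margin), by `rooms_small` (C-S9a) from the two SMALL-BOX FLOORS of each segment:
# `U·(X₁ + 1) ≤ 77·Δ` and `Δ·X₀ + |v|·U·(X₁ + 1) ≤ 76·Δ·n`, where `X₀ := L0_B + T + n` (both segments) and `X₁ := L0_A + W_B + T + La_A` (segment A),
# `X₁ := q_y + Lb_B` (segment B), `La_A = Lb_B = ⌊3nℓ/U⌋ + 1`.

builds on p205010 (kernel theorem, internal audit signed; external expert review pending) — nothing in this file uses p205010; nothing here is a
claim about the open node `SamePDropOfSkeletonNeg`.
Lane `prim-bschramm`, seat `prim-bschramm-p5` (gen 9; (C) lineage); helper file (`--supports stmt-CriticalPhenomena-4575`).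
[cite: KozmaNitzan2024, §4 Lemma 12 (pp. 23–25), p. 26 (Q_v, H_{v,x})] [cite: MartineauTassion2017, §4.3 Lemma 4.2]
-/

noncomputable section

namespace Summit.CriticalPhenomena.PercolationContinuityZ3.Theorems

namespace Transplant

namespace Skelφ

open Literature.Probability.Percolation Literature.Probability.LatticeModels
open Literature.Probability.Percolation.KozmaNitzan.Cells (oth oth_ne sgOf sgOf_sign eq_oth_of_ne)
open TwoAxis.Para (modulus)
open ChainPlanar ChainPara

/-! ## §1 Corners of driftless boxes about the origin; rooms from symmetric bounds -/

/-- The corners of `dBox a 1 0 aLo aHi bLo bHi` on the axis and across. [folklore] -/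
theorem dLoHi_one_zero (a : Fin 2) (aLo aHi bLo bHi : ℤ) :
    dLo a 1 0 aLo aHi bLo bHi a = aLo ∧ dLo a 1 0 aLo aHi bLo bHi (oth a) = bLo ∧
      dHi a 1 0 aLo aHi bLo bHi a = aHi ∧ dHi a 1 0 aLo aHi bLo bHi (oth a) = bHi := by
  simp only [dLo, dHi, if_true, if_neg (oth_ne a), Pi.zero_apply, zero_add, and_self]

section Sym

variable {A : ℤ} {n : ℕ} {h vα vβ c₀' c₁' D : ℤ} {P : PCells2} {lo hi : Site 2}

/-- **Symmetric readings `±(2r − 1)` on both axes give the rooms of every region with one unit of margin**, either corridor sign. [folklore] -/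
theorem rooms1_of_sym (hsm : ∀ i : Fin 2, -(2 * (P.r i : ℤ)) + 1 ≤ rdLo A n h vα vβ c₀' c₁' D lo hi i ∧ rdHi A n h vα vβ c₀' c₁' D lo hi i ≤ 2 * (P.r i : ℤ) - 1)
    (du : MDir) :
    (sgOf du = 1 → -(5 * (P.r du.1 : ℤ)) + 1 ≤ rdLo A n h vα vβ c₀' c₁' D lo hi du.1 ∧ rdHi A n h vα vβ c₀' c₁' D lo hi du.1 ≤ 22 * (P.r du.1 : ℤ) - 1) ∧
    (sgOf du = -1 → -(5 * (P.r du.1 : ℤ)) + 1 ≤ -rdHi A n h vα vβ c₀' c₁' D lo hi du.1 ∧ -rdLo A n h vα vβ c₀' c₁' D lo hi du.1 ≤ 22 * (P.r du.1 : ℤ) - 1) ∧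
    (-(2 * (P.r (oth du.1) : ℤ)) + 1 ≤ rdLo A n h vα vβ c₀' c₁' D lo hi (oth du.1) ∧
      rdHi A n h vα vβ c₀' c₁' D lo hi (oth du.1) ≤ 2 * (P.r (oth du.1) : ℤ) - 1) := by
  have h1 := hsm du.1
  have hr : (0 : ℤ) ≤ P.r du.1 := by positivity
  exact ⟨fun _ => ⟨by linarith [h1.1], by linarith [h1.2]⟩, fun _ => ⟨by linarith [h1.2], by linarith [h1.1]⟩, hsm (oth du.1)⟩

/-- The same without the margin (the form `reachOblRHN_negSG₂b` reads). [folklore] -/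
theorem rooms0_of_sym (hsm : ∀ i : Fin 2, -(2 * (P.r i : ℤ)) + 1 ≤ rdLo A n h vα vβ c₀' c₁' D lo hi i ∧ rdHi A n h vα vβ c₀' c₁' D lo hi i ≤ 2 * (P.r i : ℤ) - 1)
    (du : MDir) :
    (sgOf du = 1 → -(5 * (P.r du.1 : ℤ)) ≤ rdLo A n h vα vβ c₀' c₁' D lo hi du.1 ∧ rdHi A n h vα vβ c₀' c₁' D lo hi du.1 ≤ 22 * (P.r du.1 : ℤ)) ∧
    (sgOf du = -1 → -(5 * (P.r du.1 : ℤ)) ≤ -rdHi A n h vα vβ c₀' c₁' D lo hi du.1 ∧ -rdLo A n h vα vβ c₀' c₁' D lo hi du.1 ≤ 22 * (P.r du.1 : ℤ)) ∧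
    (-(2 * (P.r (oth du.1) : ℤ)) ≤ rdLo A n h vα vβ c₀' c₁' D lo hi (oth du.1) ∧
      rdHi A n h vα vβ c₀' c₁' D lo hi (oth du.1) ≤ 2 * (P.r (oth du.1) : ℤ)) := by
  obtain ⟨a, b, c⟩ := rooms1_of_sym hsm du
  exact ⟨fun hs => ⟨by linarith [(a hs).1], by linarith [(a hs).2]⟩, fun hs => ⟨by linarith [(b hs).1], by linarith [(b hs).2]⟩,
    by linarith [c.1], by linarith [c.2]⟩

end Sym

namespace CorrRec

section Rounds

variable {A : ℤ} {n : ℕ} {h v vβ c₀' c₁' D : ℤ} {P : PCells2} {ℓ T : ℕ} {aW bL : ℤ}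
  (hn : 1 ≤ n) (hA : 0 < A) (hD : 0 < D) (hm : 0 < modulus n h v vβ) (hc₀ : 0 < c₀')
  (hsc0 : c₀' * A * (40 * modulus n h v vβ) = (P.r 0 : ℤ) * D) (hsc1 : c₁' * A * (40 * modulus n h v vβ) = (P.r 1 : ℤ) * D)
include hn hA hD hm hc₀ hsc0 hsc1

/-! ## §2 Segment A: the signed v-rounds -/

/-- **Every region of the v-rounds reads inside `±(2r_i − 1)` on both axes** under the two small-box floors of segment A.
[cite: KozmaNitzan2024, §4 Lemma 12 (pp. 23–25)] -/
theorem symA (hPA : LocOKD (vLocPrmD n ℓ h v T (WA n aW) (L0A bL) (NA n ℓ h T bL)))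
    (hS1 : (shearUnit n h : ℤ) * (((L0A bL : ℕ) : ℤ) + (Qw n ℓ h : ℕ) + T + (3 * (n * ℓ) / shearUnit n h + 1 : ℕ) + 1) ≤ 77 * modulus n h v vβ)
    (hS0 : modulus n h v vβ * (((L0B n ℓ h v T aW bL : ℕ) : ℤ) + T + n) +
      |v| * ((shearUnit n h : ℤ) * (((L0A bL : ℕ) : ℤ) + (Qw n ℓ h : ℕ) + T + (3 * (n * ℓ) / shearUnit n h + 1 : ℕ) + 1)) ≤ 76 * modulus n h v vβ * n)
    {k : ℕ} (hk : k ≤ NA n ℓ h T bL) (i : Fin 2) :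
    let PA := vLocPrmD n ℓ h v T (WA n aW) (L0A bL) (NA n ℓ h T bL)
    let lo := dLo 1 1 0 (-(PA.toLoc.L k + PA.e + PA.La)) (PA.toLoc.L k + PA.e + PA.La) (-(PA.Wk k + PA.e + PA.Lb)) (PA.Wk k + PA.e + PA.Lb)
    let hi := dHi 1 1 0 (-(PA.toLoc.L k + PA.e + PA.La)) (PA.toLoc.L k + PA.e + PA.La) (-(PA.Wk k + PA.e + PA.Lb)) (PA.Wk k + PA.e + PA.Lb)
    (-(2 * (P.r i : ℤ)) + 1 ≤ rdLo A n h v vβ c₀' c₁' D lo hi i) ∧ rdHi A n h v vβ c₀' c₁' D lo hi i ≤ 2 * (P.r i : ℤ) - 1 := by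
  intro PA lo hi
  dsimp only [lo, hi]
  obtain ⟨e1, e0, e1', e0'⟩ := dLoHi_one_zero 1 (-(PA.toLoc.L k + PA.e + PA.La)) (PA.toLoc.L k + PA.e + PA.La) (-(PA.Wk k + PA.e + PA.Lb))
    (PA.Wk k + PA.e + PA.Lb)
  have ho : oth (1 : Fin 2) = 0 := by decide
  rw [ho] at e0 e0'
  -- the record's fields
  have hL0 : (PA.toLoc.L0 : ℤ) = (L0A bL : ℕ) := rfl
  have hsHi : PA.toLoc.sHi = (n : ℤ) * ℓ / (shearUnit n h : ℕ) + 1 := rfl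
  have he : (PA.e : ℤ) = T := rfl
  have hLa : (PA.La : ℤ) = ((3 * (n * ℓ) / shearUnit n h + 1 : ℕ) : ℤ) := rfl
  have hLb : (PA.Lb : ℤ) = n := rfl
  have hWk : PA.Wk k = (WA n aW : ℕ) + (k : ℤ) * (T + |v|) := rfl
  have hQ : ((Qw n ℓ h : ℕ) : ℤ) = (n : ℤ) * ℓ / (shearUnit n h : ℕ) + 1 := by unfold Qw; push_cast; rfl
  -- bounds of the corners
  have hLk : PA.toLoc.L k ≤ ((L0A bL : ℕ) : ℤ) + (Qw n ℓ h : ℕ) := by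
    have h1 := LocPrm.L_le_max (LocPrmD.toLoc_ok hPA) k
    rw [hL0, hsHi] at h1; rw [hQ]
    have h0 : (0 : ℤ) ≤ (n : ℤ) * ℓ / (shearUnit n h : ℕ) := Int.ediv_nonneg (by positivity) (by positivity)
    have hL0' : (0 : ℤ) ≤ ((L0A bL : ℕ) : ℤ) := by positivity
    exact h1.trans (max_le (by linarith) (by linarith))
  have hLk0 : 0 ≤ PA.toLoc.L k := LocPrm.L_nonneg (LocPrmD.toLoc_ok hPA) k
  have hWkb : PA.Wk k + (T + |v|) ≤ ((L0B n ℓ h v T aW bL : ℕ) : ℤ) := by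
    rw [hWk]; unfold L0B; push_cast
    have hk' : (k : ℤ) ≤ (NA n ℓ h T bL : ℕ) := by exact_mod_cast hk
    have hTv : (0 : ℤ) ≤ (T : ℤ) + |v| := by positivity
    nlinarith
  have hWk0 : 0 ≤ PA.Wk k := LocPrmD.Wk_nonneg PA k
  set X₁ : ℤ := ((L0A bL : ℕ) : ℤ) + (Qw n ℓ h : ℕ) + T + (3 * (n * ℓ) / shearUnit n h + 1 : ℕ) with hX₁
  set X₀ : ℤ := ((L0B n ℓ h v T aW bL : ℕ) : ℤ) + T + n with hX₀
  have hv0 : (0 : ℤ) ≤ |v| := abs_nonneg v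
  refine rooms_small hn hA hD hm hc₀ hsc0 hsc1 (X₀ := X₀) (X₁ := X₁) ?_ ?_ ?_ ?_ hS0 hS1 i
  · rw [e0, he, hLb]; linarith
  · rw [e0', he, hLb]; linarith
  · rw [e1, he, hLa, abs_le]; constructor <;> linarith
  · rw [e1', he, hLa, abs_le]; constructor <;> linarith

/-- **The rooms of segment A with one unit of margin** (`hrdA'` of `reachOblRHN_negSG₂b_of_inputs`). [cite: KozmaNitzan2024, §4 Lemma 12] -/
theorem hrdA1 (hPA : LocOKD (vLocPrmD n ℓ h v T (WA n aW) (L0A bL) (NA n ℓ h T bL)))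
    (hS1 : (shearUnit n h : ℤ) * (((L0A bL : ℕ) : ℤ) + (Qw n ℓ h : ℕ) + T + (3 * (n * ℓ) / shearUnit n h + 1 : ℕ) + 1) ≤ 77 * modulus n h v vβ)
    (hS0 : modulus n h v vβ * (((L0B n ℓ h v T aW bL : ℕ) : ℤ) + T + n) +
      |v| * ((shearUnit n h : ℤ) * (((L0A bL : ℕ) : ℤ) + (Qw n ℓ h : ℕ) + T + (3 * (n * ℓ) / shearUnit n h + 1 : ℕ) + 1)) ≤ 76 * modulus n h v vβ * n) :
    ∀ du : MDir, ∀ k ≤ NA n ℓ h T bL,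
      let PA := vLocPrmD n ℓ h v T (WA n aW) (L0A bL) (NA n ℓ h T bL)
      let lo := dLo 1 1 0 (-(PA.toLoc.L k + PA.e + PA.La)) (PA.toLoc.L k + PA.e + PA.La) (-(PA.Wk k + PA.e + PA.Lb)) (PA.Wk k + PA.e + PA.Lb)
      let hi := dHi 1 1 0 (-(PA.toLoc.L k + PA.e + PA.La)) (PA.toLoc.L k + PA.e + PA.La) (-(PA.Wk k + PA.e + PA.Lb)) (PA.Wk k + PA.e + PA.Lb)
      (sgOf du = 1 → -(5 * (P.r du.1 : ℤ)) + 1 ≤ rdLo A n h v vβ c₀' c₁' D lo hi du.1 ∧ rdHi A n h v vβ c₀' c₁' D lo hi du.1 ≤ 22 * (P.r du.1 : ℤ) - 1) ∧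
      (sgOf du = -1 → -(5 * (P.r du.1 : ℤ)) + 1 ≤ -rdHi A n h v vβ c₀' c₁' D lo hi du.1 ∧ -rdLo A n h v vβ c₀' c₁' D lo hi du.1 ≤ 22 * (P.r du.1 : ℤ) - 1) ∧
      (-(2 * (P.r (oth du.1) : ℤ)) + 1 ≤ rdLo A n h v vβ c₀' c₁' D lo hi (oth du.1) ∧
        rdHi A n h v vβ c₀' c₁' D lo hi (oth du.1) ≤ 2 * (P.r (oth du.1) : ℤ) - 1) :=
  fun du _ hk => rooms1_of_sym (symA hn hA hD hm hc₀ hsc0 hsc1 hPA hS1 hS0 hk) du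

/-- **The rooms of segment A** (`hrdA` of `reachOblRHN_negSG₂b`). [cite: KozmaNitzan2024, §4 Lemma 12] -/
theorem hrdA0 (hPA : LocOKD (vLocPrmD n ℓ h v T (WA n aW) (L0A bL) (NA n ℓ h T bL)))
    (hS1 : (shearUnit n h : ℤ) * (((L0A bL : ℕ) : ℤ) + (Qw n ℓ h : ℕ) + T + (3 * (n * ℓ) / shearUnit n h + 1 : ℕ) + 1) ≤ 77 * modulus n h v vβ)
    (hS0 : modulus n h v vβ * (((L0B n ℓ h v T aW bL : ℕ) : ℤ) + T + n) +
      |v| * ((shearUnit n h : ℤ) * (((L0A bL : ℕ) : ℤ) + (Qw n ℓ h : ℕ) + T + (3 * (n * ℓ) / shearUnit n h + 1 : ℕ) + 1)) ≤ 76 * modulus n h v vβ * n) :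
    ∀ du : MDir, ∀ k ≤ (vLocPrmD n ℓ h v T (WA n aW) (L0A bL) (NA n ℓ h T bL)).N,
      let PA := vLocPrmD n ℓ h v T (WA n aW) (L0A bL) (NA n ℓ h T bL)
      let lo := dLo 1 1 0 (-(PA.toLoc.L k + PA.e + PA.La)) (PA.toLoc.L k + PA.e + PA.La) (-(PA.Wk k + PA.e + PA.Lb)) (PA.Wk k + PA.e + PA.Lb)
      let hi := dHi 1 1 0 (-(PA.toLoc.L k + PA.e + PA.La)) (PA.toLoc.L k + PA.e + PA.La) (-(PA.Wk k + PA.e + PA.Lb)) (PA.Wk k + PA.e + PA.Lb)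
      (sgOf du = 1 → -(5 * (P.r du.1 : ℤ)) ≤ rdLo A n h v vβ c₀' c₁' D lo hi du.1 ∧ rdHi A n h v vβ c₀' c₁' D lo hi du.1 ≤ 22 * (P.r du.1 : ℤ)) ∧
      (sgOf du = -1 → -(5 * (P.r du.1 : ℤ)) ≤ -rdHi A n h v vβ c₀' c₁' D lo hi du.1 ∧ -rdLo A n h v vβ c₀' c₁' D lo hi du.1 ≤ 22 * (P.r du.1 : ℤ)) ∧
      (-(2 * (P.r (oth du.1) : ℤ)) ≤ rdLo A n h v vβ c₀' c₁' D lo hi (oth du.1) ∧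
        rdHi A n h v vβ c₀' c₁' D lo hi (oth du.1) ≤ 2 * (P.r (oth du.1) : ℤ)) :=
  fun du _ hk => rooms0_of_sym (symA hn hA hD hm hc₀ hsc0 hsc1 hPA hS1 hS0 hk) du

/-! ## §3 Segment B: the u-rounds -/

/-- **Every region of the u-rounds reads inside `±(2r_i − 1)` on both axes** under the two small-box floors of segment B.
[cite: KozmaNitzan2024, §4 Lemma 12 (pp. 23–25)] -/
theorem symB (hPB : LocOK (xLocPrm n ℓ h T (Qw n ℓ h) (L0B n ℓ h v T aW bL) (NB n ℓ h v T aW bL)))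
    (hS1 : (shearUnit n h : ℤ) * (((qy n ℓ h v T aW bL : ℕ) : ℤ) + (3 * (n * ℓ) / shearUnit n h + 1 : ℕ) + 1) ≤ 77 * modulus n h v vβ)
    (hS0 : modulus n h v vβ * (((L0B n ℓ h v T aW bL : ℕ) : ℤ) + T + n) +
      |v| * ((shearUnit n h : ℤ) * (((qy n ℓ h v T aW bL : ℕ) : ℤ) + (3 * (n * ℓ) / shearUnit n h + 1 : ℕ) + 1)) ≤ 76 * modulus n h v vβ * n)
    {k : ℕ} (hk : k ≤ NB n ℓ h v T aW bL) (i : Fin 2) :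
    let PB := xLocPrm n ℓ h T (Qw n ℓ h) (L0B n ℓ h v T aW bL) (NB n ℓ h v T aW bL)
    let lo := dLo 0 1 0 (-(PB.L k + PB.e + PB.La)) (PB.L k + PB.e + PB.La) (-(PB.Wk k + PB.e + PB.Lb)) (PB.Wk k + PB.e + PB.Lb)
    let hi := dHi 0 1 0 (-(PB.L k + PB.e + PB.La)) (PB.L k + PB.e + PB.La) (-(PB.Wk k + PB.e + PB.Lb)) (PB.Wk k + PB.e + PB.Lb)
    (-(2 * (P.r i : ℤ)) + 1 ≤ rdLo A n h v vβ c₀' c₁' D lo hi i) ∧ rdHi A n h v vβ c₀' c₁' D lo hi i ≤ 2 * (P.r i : ℤ) - 1 := by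
  intro PB lo hi
  dsimp only [lo, hi]
  obtain ⟨e0, e1, e0', e1'⟩ := dLoHi_one_zero 0 (-(PB.L k + PB.e + PB.La)) (PB.L k + PB.e + PB.La) (-(PB.Wk k + PB.e + PB.Lb)) (PB.Wk k + PB.e + PB.Lb)
  have ho : oth (0 : Fin 2) = 1 := by decide
  rw [ho] at e1 e1'
  have hL0 : (PB.L0 : ℤ) = (L0B n ℓ h v T aW bL : ℕ) := rfl
  have hsHi : PB.sHi = n := rfl
  have he : (PB.e : ℤ) = T := rfl
  have hLa : (PB.La : ℤ) = n := rfl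
  have hLb : (PB.Lb : ℤ) = ((3 * (n * ℓ) / shearUnit n h + 1 : ℕ) : ℤ) := rfl
  have hWk : PB.Wk k = (Qw n ℓ h : ℕ) + (k : ℤ) * T := rfl
  have hLk : PB.L k ≤ ((L0B n ℓ h v T aW bL : ℕ) : ℤ) := by
    have h1 := LocPrm.L_le_max hPB k
    rw [hL0, hsHi] at h1
    have hnL : n ≤ L0B n ℓ h v T aW bL := (n_le_WA n aW).trans (Nat.le_add_right _ _)
    have hnL' : (n : ℤ) ≤ ((L0B n ℓ h v T aW bL : ℕ) : ℤ) := by exact_mod_cast hnL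
    exact h1.trans (max_le le_rfl hnL')
  have hLk0 : 0 ≤ PB.L k := LocPrm.L_nonneg hPB k
  have hWkb : PB.Wk k + T ≤ ((qy n ℓ h v T aW bL : ℕ) : ℤ) := by
    rw [hWk]; unfold qy; push_cast
    have hk' : (k : ℤ) ≤ (NB n ℓ h v T aW bL : ℕ) := by exact_mod_cast hk
    have hT0 : (0 : ℤ) ≤ (T : ℤ) := by positivity
    nlinarith
  have hWk0 : 0 ≤ PB.Wk k := LocPrm.Wk_nonneg PB k
  set X₁ : ℤ := ((qy n ℓ h v T aW bL : ℕ) : ℤ) + (3 * (n * ℓ) / shearUnit n h + 1 : ℕ) with hX₁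
  set X₀ : ℤ := ((L0B n ℓ h v T aW bL : ℕ) : ℤ) + T + n with hX₀
  have hT0 : (0 : ℤ) ≤ (T : ℤ) := by positivity
  refine rooms_small hn hA hD hm hc₀ hsc0 hsc1 (X₀ := X₀) (X₁ := X₁) ?_ ?_ ?_ ?_ hS0 hS1 i
  · rw [e0, he, hLa]; linarith
  · rw [e0', he, hLa]; linarith
  · rw [e1, he, hLb, abs_le]; constructor <;> linarith
  · rw [e1', he, hLb, abs_le]; constructor <;> linarith

/-- **The rooms of segment B with one unit of margin** (`hrd₂'`). [cite: KozmaNitzan2024, §4 Lemma 12] -/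
theorem hrdB1 (hPB : LocOK (xLocPrm n ℓ h T (Qw n ℓ h) (L0B n ℓ h v T aW bL) (NB n ℓ h v T aW bL)))
    (hS1 : (shearUnit n h : ℤ) * (((qy n ℓ h v T aW bL : ℕ) : ℤ) + (3 * (n * ℓ) / shearUnit n h + 1 : ℕ) + 1) ≤ 77 * modulus n h v vβ)
    (hS0 : modulus n h v vβ * (((L0B n ℓ h v T aW bL : ℕ) : ℤ) + T + n) +
      |v| * ((shearUnit n h : ℤ) * (((qy n ℓ h v T aW bL : ℕ) : ℤ) + (3 * (n * ℓ) / shearUnit n h + 1 : ℕ) + 1)) ≤ 76 * modulus n h v vβ * n) :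
    ∀ du : MDir, ∀ k ≤ NB n ℓ h v T aW bL,
      let PB := xLocPrm n ℓ h T (Qw n ℓ h) (L0B n ℓ h v T aW bL) (NB n ℓ h v T aW bL)
      let lo := dLo 0 1 0 (-(PB.L k + PB.e + PB.La)) (PB.L k + PB.e + PB.La) (-(PB.Wk k + PB.e + PB.Lb)) (PB.Wk k + PB.e + PB.Lb)
      let hi := dHi 0 1 0 (-(PB.L k + PB.e + PB.La)) (PB.L k + PB.e + PB.La) (-(PB.Wk k + PB.e + PB.Lb)) (PB.Wk k + PB.e + PB.Lb)
      (sgOf du = 1 → -(5 * (P.r du.1 : ℤ)) + 1 ≤ rdLo A n h v vβ c₀' c₁' D lo hi du.1 ∧ rdHi A n h v vβ c₀' c₁' D lo hi du.1 ≤ 22 * (P.r du.1 : ℤ) - 1) ∧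
      (sgOf du = -1 → -(5 * (P.r du.1 : ℤ)) + 1 ≤ -rdHi A n h v vβ c₀' c₁' D lo hi du.1 ∧ -rdLo A n h v vβ c₀' c₁' D lo hi du.1 ≤ 22 * (P.r du.1 : ℤ) - 1) ∧
      (-(2 * (P.r (oth du.1) : ℤ)) + 1 ≤ rdLo A n h v vβ c₀' c₁' D lo hi (oth du.1) ∧
        rdHi A n h v vβ c₀' c₁' D lo hi (oth du.1) ≤ 2 * (P.r (oth du.1) : ℤ) - 1) :=
  fun du _ hk => rooms1_of_sym (symB hn hA hD hm hc₀ hsc0 hsc1 hPB hS1 hS0 hk) du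

/-- **The rooms of segment B** (`hrd₂`). [cite: KozmaNitzan2024, §4 Lemma 12] -/
theorem hrdB0 (hPB : LocOK (xLocPrm n ℓ h T (Qw n ℓ h) (L0B n ℓ h v T aW bL) (NB n ℓ h v T aW bL)))
    (hS1 : (shearUnit n h : ℤ) * (((qy n ℓ h v T aW bL : ℕ) : ℤ) + (3 * (n * ℓ) / shearUnit n h + 1 : ℕ) + 1) ≤ 77 * modulus n h v vβ)
    (hS0 : modulus n h v vβ * (((L0B n ℓ h v T aW bL : ℕ) : ℤ) + T + n) +
      |v| * ((shearUnit n h : ℤ) * (((qy n ℓ h v T aW bL : ℕ) : ℤ) + (3 * (n * ℓ) / shearUnit n h + 1 : ℕ) + 1)) ≤ 76 * modulus n h v vβ * n) :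
    ∀ du : MDir, ∀ k ≤ (xLocPrm n ℓ h T (Qw n ℓ h) (L0B n ℓ h v T aW bL) (NB n ℓ h v T aW bL)).N,
      let PB := xLocPrm n ℓ h T (Qw n ℓ h) (L0B n ℓ h v T aW bL) (NB n ℓ h v T aW bL)
      let lo := dLo 0 1 0 (-(PB.L k + PB.e + PB.La)) (PB.L k + PB.e + PB.La) (-(PB.Wk k + PB.e + PB.Lb)) (PB.Wk k + PB.e + PB.Lb)
      let hi := dHi 0 1 0 (-(PB.L k + PB.e + PB.La)) (PB.L k + PB.e + PB.La) (-(PB.Wk k + PB.e + PB.Lb)) (PB.Wk k + PB.e + PB.Lb)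
      (sgOf du = 1 → -(5 * (P.r du.1 : ℤ)) ≤ rdLo A n h v vβ c₀' c₁' D lo hi du.1 ∧ rdHi A n h v vβ c₀' c₁' D lo hi du.1 ≤ 22 * (P.r du.1 : ℤ)) ∧
      (sgOf du = -1 → -(5 * (P.r du.1 : ℤ)) ≤ -rdHi A n h v vβ c₀' c₁' D lo hi du.1 ∧ -rdLo A n h v vβ c₀' c₁' D lo hi du.1 ≤ 22 * (P.r du.1 : ℤ)) ∧
      (-(2 * (P.r (oth du.1) : ℤ)) ≤ rdLo A n h v vβ c₀' c₁' D lo hi (oth du.1) ∧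
        rdHi A n h v vβ c₀' c₁' D lo hi (oth du.1) ≤ 2 * (P.r (oth du.1) : ℤ)) :=
  fun du _ hk => rooms0_of_sym (symB hn hA hD hm hc₀ hsc0 hsc1 hPB hS1 hS0 hk) du

end Rounds

end CorrRec

end Skelφ

end Transplant

end Summit.CriticalPhenomena.PercolationContinuityZ3.Theorems

end
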